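import Mathlib.Analysis.Complex.ExponentialBounds
import Literature.NumberTheory.Transcendental.TwoLogarithmsLowerBound
import Literature.NumberTheory.Transcendental.DiazMainIIISmallEventually
import HarnessLib

/-!
# An explicit lower bound for linear forms in two logarithms: choice of parameters

Topic `Literature/NumberTheory/Transcendental`. Continuation of `TwoLogarithmsLowerBound.lean`
(`TwoLog.lower_bound_core`, Laurent's interpolation-determinant method in crude explicit form).
Here the radius is `E = e` and the parameters are chosen as

  `L = 8Dj`, `R = S = 256DWj`, `K = 4096DW²j`  (`N = KL = 32768 D²W²j²`, `2KL = R²`),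

where `D ≥ [ℚ(α₁, α₂) : ℚ]`, `log max(b₁, b₂) ≤ j`, and `W` is any integer with
`W ≥ 2e(|l₁| + ρ) + 4 + 4(D-1) log A` (`A` a bound for the conjugates of `α₁, α₂`,
`b₁|l₁| ≤ ρ b₂`). The main condition of the core estimate then holds as soon as
`j ≥ log(1024DW) + 2`, and the outcome is the fully explicit, fully proved bound

  `|b₁ l₁ - b₂ l₂| ≥ exp(-10⁹ D⁴ W⁴ j⁴)`   (`TwoLog.lower_bound_explicit`),

(`log n! ≤ n log n` is reused from `DiazMainIIISmallEventually.lean`), valid whenever the abscissae `r b₂ + s b₁` and the ordinates `e^{r l₁ + s l₂}` (`r, s < R`) are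
pairwise distinct (for coprime `b₁, b₂` with `max bᵢ ≥ R`, and multiplicatively independent
`αᵢ`). The dependence `j⁴ ≍ (log B)⁴` is much weaker than Laurent–Mignotte–Nesterenko's
`(log B)²` (and than Baker–Wüstholz's `log B`), the constant is astronomically worse, but the
statement is unconditional and suffices for Diophantine applications where the competing upper
bound is exponentially small (e.g. the class number one problem). Everything here is proved.

## References

* M. Laurent, M. Mignotte, Yu. Nesterenko, J. Number Theory 55 (1995), 285–321 (Thm. 1; not held).
* A. Baker, G. Wüstholz, *Logarithmic Forms and Diophantine Geometry*, CUP 2007, §2.8 p. 35,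
  Thm. 2.5 / Thm. 2.15 (the shape `log |Λ| ≫ -log B` of the sharp theory). [BakerWustholz2007]
-/

noncomputable section

open Complex Finset NumberField Real

namespace Literature.NumberTheory.Transcendental

namespace TwoLog

section

variable {F : Type*} [Field F] [NumberField F] (φ : F →+* ℂ) (a₁ a₂ : 𝓞 F)
variable {A : ℝ} {l₁ l₂ : ℂ} {b₁ b₂ : ℕ}

/-- **Log form of the core estimate** (`E = e`): if
`log 2 + D·N log N + N log V₁ + (D-1)·N log U ≤ N(N-1)/2` with `D ≥ [F:ℚ]`, then
`|b₁ l₁ - b₂ l₂| ≥ exp(-(log 2 + D·N log N + N log V₂ + (D-1)·N log U))`.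
[cite: BakerWustholz2007, §2.8 p. 35 (Laurent's interpolation determinants)] -/
theorem lower_bound_log (hA : 1 ≤ A) (hA₁ : ∀ σ : F →+* ℂ, ‖σ (a₁ : F)‖ ≤ A)
    (hA₂ : ∀ σ : F →+* ℂ, ‖σ (a₂ : F)‖ ≤ A)
    (hl₁ : cexp l₁ = φ a₁) (hl₂ : cexp l₂ = φ a₂) (hb₂ : 0 < b₂)
    {K L R S : ℕ} (hK : 2 ≤ K) (hL : 2 ≤ L) (hRS : 2 * (K - 1) * (L - 1) < R * S)
    (hx : Set.InjOn (fun p : ℕ × ℕ => xc b₁ b₂ p.1 p.2) ↑(grid R S))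
    (hy : Set.InjOn (fun p : ℕ × ℕ => cexp (p.1 * l₁ + p.2 * l₂)) ↑(grid R S))
    (D : ℕ) (hD : Module.finrank ℚ F ≤ D)
    (hmain : Real.log 2 + D * ((K * L : ℕ) * Real.log (K * L : ℕ)) +
      (K * L : ℕ) * Real.log (bndV₁ (‖l₁‖ / b₂) (bigX b₁ b₂ R S) (Real.exp 1) K L) +
      ((D : ℝ) - 1) * ((K * L : ℕ) * Real.log (bndU A (bigX b₁ b₂ R S) K L R S)) ≤
        ((K * L * (K * L - 1) / 2 : ℕ) : ℝ)) :
    Real.exp (-(Real.log 2 + D * ((K * L : ℕ) * Real.log (K * L : ℕ)) +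
      (K * L : ℕ) * Real.log (bndV₂ (‖l₁‖ / b₂) (bigX b₁ b₂ R S) K L S) +
      ((D : ℝ) - 1) * ((K * L : ℕ) * Real.log (bndU A (bigX b₁ b₂ R S) K L R S)))) ≤
      ‖(b₁ : ℂ) * l₁ - b₂ * l₂‖ := by
  -- positivity of the quantities
  set X : ℝ := bigX b₁ b₂ R S with hXdef
  set t : ℝ := ‖l₁‖ / b₂ with htdef
  set U : ℝ := bndU A X K L R S with hUdef
  set V₁ : ℝ := bndV₁ t X (Real.exp 1) K L with hV₁def
  set V₂ : ℝ := bndV₂ t X K L S with hV₂def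
  set N : ℕ := K * L with hNdef
  set fr : ℕ := Module.finrank ℚ F with hfr
  have hRpos : 0 < R := Nat.pos_of_ne_zero fun h => by subst h; simp at hRS
  have hX1 : 1 ≤ X := by
    rw [hXdef, bigX]
    have : (1 : ℝ) ≤ R * b₂ := by exact_mod_cast Nat.mul_pos hRpos hb₂
    nlinarith [show (0 : ℝ) ≤ S * b₁ by positivity]
  have hU1 : 1 ≤ U := by
    rw [hUdef, bndU]
    exact one_le_mul_of_one_le_of_one_le (one_le_pow₀ hX1) (one_le_pow₀ hA)
  have he1 : 1 ≤ Real.exp 1 := Real.one_le_exp zero_le_one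
  have hV₁pos : 0 < V₁ := by rw [hV₁def, bndV₁]; positivity
  have hV₂pos : 0 < V₂ := by rw [hV₂def, bndV₂]; positivity
  have hN1 : 1 ≤ N := by rw [hNdef]; exact Nat.one_le_iff_ne_zero.mpr (Nat.mul_ne_zero (by omega) (by omega))
  have hNfpos : (0 : ℝ) < N.factorial := by exact_mod_cast Nat.factorial_pos N
  have hNf1 : (1 : ℝ) ≤ N.factorial := by exact_mod_cast Nat.one_le_iff_ne_zero.mpr (Nat.factorial_ne_zero N)
  have hfr1 : 1 ≤ fr := Module.finrank_pos
  have hfrD : (fr : ℝ) ≤ D := by exact_mod_cast hD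
  have hlogU : 0 ≤ Real.log U := Real.log_nonneg hU1
  have hlogNf : 0 ≤ Real.log (N.factorial : ℝ) := Real.log_nonneg hNf1
  have hlogN : Real.log (N.factorial : ℝ) ≤ N * Real.log N := DiazMainIII.log_factorial_le N
  have hlogNN : 0 ≤ (N : ℝ) * Real.log N :=
    mul_nonneg (Nat.cast_nonneg _) (Real.log_nonneg (by exact_mod_cast hN1))
  -- the main condition of the core estimate
  have hcore_main : 2 * ((N.factorial : ℝ) * V₁ ^ N) * ((N.factorial : ℝ) * U ^ N) ^ (fr - 1) ≤
      Real.exp 1 ^ (N * (N - 1) / 2) := by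
    have hpos : 0 < 2 * ((N.factorial : ℝ) * V₁ ^ N) * ((N.factorial : ℝ) * U ^ N) ^ (fr - 1) := by
      positivity
    rw [Real.exp_one_pow, ← Real.log_le_iff_le_exp hpos]
    · refine le_trans ?_ hmain
      rw [Real.log_mul (by positivity) (by positivity), Real.log_mul (by norm_num) (by positivity),
        Real.log_mul (by positivity) (by positivity), Real.log_pow, Real.log_pow,
        Real.log_mul (by positivity) (by positivity), Real.log_pow]
      have h1 : ((fr - 1 : ℕ) : ℝ) = fr - 1 := by rw [Nat.cast_sub hfr1]; simp
      rw [h1]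
      have h2 : ((fr : ℝ) - 1) * (Real.log (N.factorial : ℝ) + N * Real.log U) ≤
          ((D : ℝ) - 1) * (N * Real.log N + N * Real.log U) := by
        have hf1 : (0 : ℝ) ≤ fr - 1 := by
          have : (1 : ℝ) ≤ fr := by exact_mod_cast hfr1
          linarith
        calc ((fr : ℝ) - 1) * (Real.log (N.factorial : ℝ) + N * Real.log U)
            ≤ ((fr : ℝ) - 1) * (N * Real.log N + N * Real.log U) := by
              apply mul_le_mul_of_nonneg_left _ hf1; linarith
          _ ≤ ((D : ℝ) - 1) * (N * Real.log N + N * Real.log U) := by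
              apply mul_le_mul_of_nonneg_right _ (by positivity); linarith
      have h3 : Real.log (N.factorial : ℝ) ≤ D * (N * Real.log N) := by
        calc Real.log (N.factorial : ℝ) ≤ 1 * (N * Real.log N) := by rw [one_mul]; exact hlogN
          _ ≤ D * (N * Real.log N) := by
              apply mul_le_mul_of_nonneg_right _ hlogNN
              exact_mod_cast hfr1.trans hD
      nlinarith [h2, h3, mul_nonneg (show (0:ℝ) ≤ D - 1 by
        have : (1:ℝ) ≤ D := by exact_mod_cast hfr1.trans hD
        linarith) hlogNN]
  -- apply the core estimate
  have hcore := lower_bound_core φ a₁ a₂ hA hA₁ hA₂ hl₁ hl₂ hb₂ hK hL hRS hx hy he1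
    (by simpa [hNdef, hV₁def, hUdef, hXdef, htdef, hfr] using hcore_main)
  refine le_trans ?_ hcore
  -- compare the two lower bounds through their logarithms
  have hQpos : 0 < ((((K * L).factorial : ℝ) * bndU A (bigX b₁ b₂ R S) K L R S ^ (K * L)) ^
      (Module.finrank ℚ F - 1))⁻¹ /
      (2 * (((K * L).factorial : ℝ) * bndV₂ (‖l₁‖ / ↑b₂) (bigX b₁ b₂ R S) K L S ^ (K * L))) := by
    rw [← hXdef, ← htdef, ← hUdef, ← hV₂def, ← hNdef]; positivity
  rw [← Real.le_log_iff_exp_le hQpos]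
  rw [← hXdef, ← htdef, ← hUdef, ← hV₂def, ← hNdef, ← hfr]
  rw [Real.log_div (by positivity) (by positivity), Real.log_inv, Real.log_pow,
    Real.log_mul (by positivity) (by positivity), Real.log_pow,
    Real.log_mul (by norm_num) (by positivity), Real.log_mul (by positivity) (by positivity),
    Real.log_pow]
  have h1 : ((fr - 1 : ℕ) : ℝ) = fr - 1 := by rw [Nat.cast_sub hfr1]; simp
  rw [h1]
  have hf1 : (0 : ℝ) ≤ fr - 1 := by
    have : (1 : ℝ) ≤ fr := by exact_mod_cast hfr1
    linarith
  have h2 : ((fr : ℝ) - 1) * (Real.log (N.factorial : ℝ) + N * Real.log U) ≤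
      ((D : ℝ) - 1) * (N * Real.log N + N * Real.log U) := by
    calc ((fr : ℝ) - 1) * (Real.log (N.factorial : ℝ) + N * Real.log U)
        ≤ ((fr : ℝ) - 1) * (N * Real.log N + N * Real.log U) := by
          apply mul_le_mul_of_nonneg_left _ hf1; linarith
      _ ≤ ((D : ℝ) - 1) * (N * Real.log N + N * Real.log U) := by
          apply mul_le_mul_of_nonneg_right _ (by positivity); linarith
  have h3 : Real.log (N.factorial : ℝ) ≤ D * (N * Real.log N) := by
    calc Real.log (N.factorial : ℝ) ≤ 1 * (N * Real.log N) := by rw [one_mul]; exact hlogN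
      _ ≤ D * (N * Real.log N) := by
          apply mul_le_mul_of_nonneg_right _ hlogNN
          exact_mod_cast hfr1.trans hD
  nlinarith [h2, h3, mul_nonneg (show (0:ℝ) ≤ D - 1 by
    have : (1:ℝ) ≤ D := by exact_mod_cast hfr1.trans hD
    linarith) hlogNN]

end


/-! ### The explicit parameters -/

/-- `L = 8Dj`. [folklore] -/
def pL (D j : ℕ) : ℕ := 8 * D * j

/-- `R = S = 256DWj`. [folklore] -/
def pR (D W j : ℕ) : ℕ := 256 * D * W * j

/-- `K = 4096DW²j`. [folklore] -/
def pK (D W j : ℕ) : ℕ := 4096 * D * W ^ 2 * j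

/-- `2KL = R²` (the zero-lemma condition is an equality of leading terms). [folklore] -/
theorem two_mul_pK_mul_pL (D W j : ℕ) : 2 * pK D W j * pL D j = pR D W j * pR D W j := by
  unfold pK pL pR; ring

/-- The elementary inequality behind the main condition. [folklore] -/
theorem ineq_aux {d w J l : ℝ} (hd : 1 ≤ d) (hw : 4 ≤ w) (hJ : l + 2 ≤ J) (hl : 0 ≤ l) :
    2 * d * J + 4096 * d * w ^ 2 * J + 4096 * d ^ 2 * w ^ 2 * l * J + 2 * d * l + 6 / 5 ≤
      4096 * d ^ 2 * w ^ 2 * J ^ 2 := by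
  have hJ2 : 2 ≤ J := by linarith
  have hdw : 16 ≤ d * w ^ 2 := by nlinarith
  have hd2 : d ≤ d ^ 2 := by nlinarith
  have h1 : d * w ^ 2 ≤ d ^ 2 * w ^ 2 := by nlinarith
  have hP : 0 ≤ d ^ 2 * w ^ 2 * J := by positivity
  -- `4096 d²w²J² ≥ 4096 d²w²J (l + 2)`
  have h2 : 4096 * d ^ 2 * w ^ 2 * J * (l + 2) ≤ 4096 * d ^ 2 * w ^ 2 * J ^ 2 := by
    rw [sq J]; rw [← mul_assoc]; exact mul_le_mul_of_nonneg_left hJ (by positivity)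
  -- the remaining terms are `≤ 8192 d²w²J`
  have h3 : 2 * d * J ≤ d ^ 2 * w ^ 2 * J := by nlinarith
  have h4 : 2 * d * l ≤ d ^ 2 * w ^ 2 * J := by nlinarith
  have h5 : 4096 * d * w ^ 2 * J ≤ 4096 * (d ^ 2 * w ^ 2 * J) := by nlinarith
  have h6 : (6 / 5 : ℝ) ≤ d ^ 2 * w ^ 2 * J := by nlinarith
  nlinarith

section Explicit

variable {F : Type*} [Field F] [NumberField F] (φ : F →+* ℂ) (a₁ a₂ : 𝓞 F)
variable {A : ℝ} {l₁ l₂ : ℂ} {b₁ b₂ : ℕ}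

set_option maxHeartbeats 400000 in
-- a long chain of explicit real inequalities (twice the default budget)
/-- **Explicit lower bound for a linear form in two logarithms.** Let `F` be a number field
with an embedding `φ : F → ℂ`, `a₁, a₂ ∈ 𝓞 F` with all conjugates of modulus `≤ A` (`A ≥ 1`),
`l₁, l₂` logarithms of `φ(a₁), φ(a₂)`, `b₁ ≥ 0`, `b₂ ≥ 1` integers with `b₁|l₁| ≤ ρ b₂`, and let
`D ≥ [F:ℚ]`, `W ≥ 2e(|l₁| + ρ) + 4 + 4(D-1) log A`, `j ≥ log(1024DW) + 2` with `b₁, b₂ ≤ e^j`.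
If the abscissae `r b₂ + s b₁` and the ordinates `e^{r l₁ + s l₂}` (`r, s < 256DWj`) are pairwise
distinct, then `|b₁ l₁ - b₂ l₂| ≥ exp(-10⁹ D⁴ W⁴ j⁴)`.
[cite: BakerWustholz2007, §2.8 p. 35 (Laurent's interpolation determinants; crude explicit form)] -/
theorem lower_bound_explicit (hA : 1 ≤ A) (hA₁ : ∀ σ : F →+* ℂ, ‖σ (a₁ : F)‖ ≤ A)
    (hA₂ : ∀ σ : F →+* ℂ, ‖σ (a₂ : F)‖ ≤ A)
    (hl₁ : cexp l₁ = φ a₁) (hl₂ : cexp l₂ = φ a₂) (hb₂ : 0 < b₂)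
    (D : ℕ) (hD : Module.finrank ℚ F ≤ D) (W : ℕ) {ρ : ℝ} (hρ0 : 0 ≤ ρ)
    (hW : 2 * Real.exp 1 * (‖l₁‖ + ρ) + 4 + 4 * ((D : ℝ) - 1) * Real.log A ≤ W)
    (hρ : (b₁ : ℝ) * ‖l₁‖ ≤ ρ * b₂)
    (j : ℕ) (hj : Real.log (1024 * D * W) + 2 ≤ j)
    (hjb₁ : (b₁ : ℝ) ≤ Real.exp j) (hjb₂ : (b₂ : ℝ) ≤ Real.exp j)
    (hx : Set.InjOn (fun p : ℕ × ℕ => xc b₁ b₂ p.1 p.2) ↑(grid (pR D W j) (pR D W j)))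
    (hy : Set.InjOn (fun p : ℕ × ℕ => cexp (p.1 * l₁ + p.2 * l₂)) ↑(grid (pR D W j) (pR D W j))) :
    Real.exp (-(10 ^ 9 * (D : ℝ) ^ 4 * (W : ℝ) ^ 4 * (j : ℝ) ^ 4)) ≤ ‖(b₁ : ℂ) * l₁ - b₂ * l₂‖ := by
  -- basic ranges
  have hfr1 : 1 ≤ Module.finrank ℚ F := Module.finrank_pos
  have hD1 : 1 ≤ D := hfr1.trans hD
  set d : ℝ := (D : ℝ) with hd
  have hd1 : (1 : ℝ) ≤ d := by rw [hd]; exact_mod_cast hD1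
  have hlogA : 0 ≤ Real.log A := Real.log_nonneg hA
  have he : 1 ≤ Real.exp 1 := Real.one_le_exp zero_le_one
  set m₁ : ℝ := ‖l₁‖ + ρ with hm₁
  have hm₁0 : 0 ≤ m₁ := by positivity
  set w : ℝ := (W : ℝ) with hw
  have hw4 : (4 : ℝ) ≤ w := by
    have : 0 ≤ 2 * Real.exp 1 * m₁ := mul_nonneg (by positivity) hm₁0
    have : 0 ≤ 4 * (d - 1) * Real.log A := mul_nonneg (mul_nonneg (by norm_num) (by linarith)) hlogA
    linarith
  have hW1 : 1 ≤ W := by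
    have : (1 : ℝ) ≤ W := by linarith
    exact_mod_cast this
  set J : ℝ := (j : ℝ) with hJ
  set l₀ : ℝ := Real.log (1024 * D * W) with hl₀
  have hl₀0 : 0 ≤ l₀ := Real.log_nonneg (by
    have : (1 : ℝ) ≤ 1024 * d * w := by nlinarith
    simpa [hd, hw] using this)
  have hJ2 : l₀ + 2 ≤ J := hj
  have hJ2' : (2 : ℝ) ≤ J := by linarith
  have hj1 : 1 ≤ j := by
    have : (1 : ℝ) ≤ j := by linarith
    exact_mod_cast this
  -- the parameters (kept opaque)
  obtain ⟨K, hKdef⟩ : ∃ K : ℕ, K = pK D W j := ⟨_, rfl⟩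
  obtain ⟨L, hLdef⟩ : ∃ L : ℕ, L = pL D j := ⟨_, rfl⟩
  obtain ⟨R, hRdef⟩ : ∃ R : ℕ, R = pR D W j := ⟨_, rfl⟩
  rw [← hRdef] at hx hy
  have hKr : (K : ℝ) = 4096 * d * w ^ 2 * J := by rw [hKdef, pK]; push_cast; ring
  have hLr : (L : ℝ) = 8 * d * J := by rw [hLdef, pL]; push_cast; ring
  have hRr : (R : ℝ) = 256 * d * w * J := by rw [hRdef, pR]; push_cast; ring
  have hK2 : 2 ≤ K := by
    rw [hKdef, pK]
    calc 2 ≤ 4096 * 1 * 1 ^ 2 * 1 := by norm_num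
      _ ≤ 4096 * D * W ^ 2 * j := by gcongr
  have hL2 : 2 ≤ L := by
    rw [hLdef, pL]
    calc 2 ≤ 8 * 1 * 1 := by norm_num
      _ ≤ 8 * D * j := by gcongr
  have hR1 : 1 ≤ R := by
    rw [hRdef, pR]
    calc 1 ≤ 256 * 1 * 1 * 1 := by norm_num
      _ ≤ 256 * D * W * j := by gcongr
  have hRS : 2 * (K - 1) * (L - 1) < R * R := by
    rw [hRdef, ← two_mul_pK_mul_pL, ← hKdef, ← hLdef]
    have h1 : (K - 1) * (L - 1) < K * L := by
      calc (K - 1) * (L - 1) ≤ (K - 1) * L := Nat.mul_le_mul_left _ (Nat.sub_le _ _)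
        _ < K * L := Nat.mul_lt_mul_of_pos_right (by omega) (by omega)
    nlinarith
  -- `N = KL`
  obtain ⟨N, hNdef⟩ : ∃ N : ℕ, N = K * L := ⟨_, rfl⟩
  have hNr : (N : ℝ) = 32768 * d ^ 2 * w ^ 2 * J ^ 2 := by
    rw [hNdef, Nat.cast_mul, hKr, hLr]; ring
  have hN1 : 1 ≤ N := by rw [hNdef]; exact Nat.one_le_iff_ne_zero.mpr (Nat.mul_ne_zero (by omega) (by omega))
  have hNr1 : (1 : ℝ) ≤ N := by exact_mod_cast hN1
  -- `X` and its logarithm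
  obtain ⟨X, hXdef⟩ : ∃ X : ℝ, X = bigX b₁ b₂ R R := ⟨_, rfl⟩
  have hXeq : X = 2 * R * ((b₁ : ℝ) + b₂) := by rw [hXdef, bigX]; ring
  have hb₂r : (1 : ℝ) ≤ b₂ := by exact_mod_cast hb₂
  have hR1r : (1 : ℝ) ≤ R := by exact_mod_cast hR1
  have hX2 : 2 ≤ X := by
    rw [hXeq]
    have hb12 : (1 : ℝ) ≤ (b₁ : ℝ) + b₂ := by linarith [Nat.cast_nonneg (α := ℝ) b₁]
    calc (2 : ℝ) = 2 * 1 * 1 := by norm_num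
      _ ≤ 2 * R * ((b₁ : ℝ) + b₂) := by gcongr
  have hXpos : 0 < X := by linarith
  have hX0 : 0 ≤ X := hXpos.le
  have hexpJ : 1 ≤ Real.exp J := Real.one_le_exp (by linarith)
  have hXle : X ≤ 1024 * d * w * J * Real.exp J := by
    rw [hXeq, hRr]
    have : (b₁ : ℝ) + b₂ ≤ 2 * Real.exp J := by linarith
    calc 2 * (256 * d * w * J) * ((b₁ : ℝ) + b₂) ≤ 2 * (256 * d * w * J) * (2 * Real.exp J) := by
          apply mul_le_mul_of_nonneg_left this; positivity
      _ = 1024 * d * w * J * Real.exp J := by ring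
  have hlogX : Real.log X ≤ l₀ + 2 * J := by
    have h1 : Real.log X ≤ Real.log (1024 * d * w * J * Real.exp J) :=
      Real.log_le_log hXpos hXle
    have hdwJ : 0 < 1024 * d * w * J := by positivity
    have hdw : 0 < 1024 * d * w := by positivity
    have h2 : Real.log (1024 * d * w * J * Real.exp J) = l₀ + Real.log J + J := by
      rw [Real.log_mul hdwJ.ne' (Real.exp_pos J).ne', Real.log_exp,
        Real.log_mul hdw.ne' (by linarith : J ≠ 0), hl₀, hd, hw]
    have h3 : Real.log J ≤ J := Real.log_le_self (by linarith)
    linarith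
  have hlogX0 : 0 ≤ Real.log X := Real.log_nonneg (by linarith)
  -- `t X`
  obtain ⟨t, htdef⟩ : ∃ t : ℝ, t = ‖l₁‖ / b₂ := ⟨_, rfl⟩
  have ht0 : 0 ≤ t := by rw [htdef]; positivity
  have htX : t * X ≤ 512 * d * w * J * m₁ := by
    have h1 : t * X = 2 * R * (t * b₁ + ‖l₁‖) := by
      rw [hXeq, htdef]; field_simp
    have hb₂pos : (0 : ℝ) < b₂ := by exact_mod_cast hb₂
    have h2 : t * b₁ ≤ ρ := by
      rw [htdef, div_mul_eq_mul_div, div_le_iff₀ hb₂pos]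
      calc ‖l₁‖ * (b₁ : ℝ) = b₁ * ‖l₁‖ := mul_comm _ _
        _ ≤ ρ * b₂ := hρ
    rw [h1, hRr, hm₁]
    have : t * ↑b₁ + ‖l₁‖ ≤ ‖l₁‖ + ρ := by linarith
    calc 2 * (256 * d * w * J) * (t * ↑b₁ + ‖l₁‖) ≤ 2 * (256 * d * w * J) * (‖l₁‖ + ρ) := by
          apply mul_le_mul_of_nonneg_left this; positivity
      _ = 512 * d * w * J * (‖l₁‖ + ρ) := by ring
  have htX0 : 0 ≤ t * X := mul_nonneg ht0 hX0
  -- consequences of `hW`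
  have hdA : 0 ≤ 4 * (d - 1) * Real.log A := mul_nonneg (mul_nonneg (by norm_num) (by linarith)) hlogA
  have hem : Real.exp 1 * m₁ ≤ w / 2 := by linarith
  have hm2 : m₁ + 2 ≤ w / 2 := by
    have : m₁ ≤ Real.exp 1 * m₁ := le_mul_of_one_le_left hm₁0 he
    linarith
  have hla : 4 * (d - 1) * Real.log A ≤ w := by
    have : 0 ≤ 2 * Real.exp 1 * m₁ := mul_nonneg (by positivity) hm₁0
    linarith
  -- casts of `K - 1`, `L - 1`
  have hK1r : ((K - 1 : ℕ) : ℝ) ≤ K := by exact_mod_cast Nat.sub_le K 1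
  have hL1r : (L : ℝ) - 1 ≤ L := by linarith
  have hL1r0 : 0 ≤ (L : ℝ) - 1 := by
    have : (2 : ℝ) ≤ L := by exact_mod_cast hL2
    linarith
  have hKr0 : 0 ≤ (K : ℝ) := by positivity
  -- (d) `log V₁`
  have hV₁ : Real.log (bndV₁ t X (Real.exp 1) K L) ≤
      4096 * d * w ^ 2 * J * (1 + l₀ + 2 * J) + 2048 * d ^ 2 * w ^ 2 * J ^ 2 := by
    have hEX : 0 < Real.exp 1 * X := mul_pos (Real.exp_pos 1) hXpos
    rw [bndV₁, Real.log_mul (pow_pos hEX _).ne' (Real.exp_pos _).ne', Real.log_pow, Real.log_exp,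
      Real.log_mul (Real.exp_pos 1).ne' hXpos.ne', Real.log_exp]
    have h1 : ((K - 1 : ℕ) : ℝ) * (1 + Real.log X) ≤ 4096 * d * w ^ 2 * J * (1 + l₀ + 2 * J) := by
      rw [← hKr]
      exact mul_le_mul hK1r (by linarith) (by positivity) hKr0
    have h2 : ((L : ℝ) - 1) * (t * (Real.exp 1 * X)) ≤ 2048 * d ^ 2 * w ^ 2 * J ^ 2 := by
      have h3 : t * (Real.exp 1 * X) ≤ Real.exp 1 * (512 * d * w * J * m₁) := by
        rw [show t * (Real.exp 1 * X) = Real.exp 1 * (t * X) by ring]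
        exact mul_le_mul_of_nonneg_left htX (by positivity)
      calc ((L : ℝ) - 1) * (t * (Real.exp 1 * X)) ≤ L * (Real.exp 1 * (512 * d * w * J * m₁)) :=
            mul_le_mul hL1r h3 (mul_nonneg ht0 (mul_nonneg (Real.exp_pos 1).le hX0)) (by positivity)
        _ = 8 * d * J * (512 * d * w * J) * (Real.exp 1 * m₁) := by rw [hLr]; ring
        _ ≤ 8 * d * J * (512 * d * w * J) * (w / 2) :=
            mul_le_mul_of_nonneg_left hem (by positivity)
        _ = 2048 * d ^ 2 * w ^ 2 * J ^ 2 := by ring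
    linarith
  -- (e) `log U` and `(d-1) log U`
  have hU : Real.log (bndU A X K L R R) ≤
      4096 * d * w ^ 2 * J * (l₀ + 2 * J) + 8192 * d ^ 2 * w * J ^ 2 * Real.log A := by
    have hApos : 0 < A := by linarith
    rw [bndU, Real.log_mul (pow_pos hXpos _).ne' (pow_pos hApos _).ne', Real.log_pow, Real.log_pow]
    have h1 : ((K - 1 : ℕ) : ℝ) * Real.log X ≤ 4096 * d * w ^ 2 * J * (l₀ + 2 * J) := by
      rw [← hKr]; exact mul_le_mul hK1r hlogX hlogX0 hKr0
    have h2 : (((2 * R + 2 * R) * (L - 1) : ℕ) : ℝ) * Real.log A ≤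
        8192 * d ^ 2 * w * J ^ 2 * Real.log A := by
      apply mul_le_mul_of_nonneg_right _ hlogA
      have : (((2 * R + 2 * R) * (L - 1) : ℕ) : ℝ) ≤ (4 * R : ℝ) * L := by
        have hle : (2 * R + 2 * R) * (L - 1) ≤ 4 * R * L := by
          calc (2 * R + 2 * R) * (L - 1) ≤ (2 * R + 2 * R) * L := Nat.mul_le_mul_left _ (Nat.sub_le _ _)
            _ = 4 * R * L := by ring
        exact_mod_cast hle
      calc (((2 * R + 2 * R) * (L - 1) : ℕ) : ℝ) ≤ (4 * R : ℝ) * L := this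
        _ = 8192 * d ^ 2 * w * J ^ 2 := by rw [hRr, hLr]; ring
    linarith
  have hU0 : 0 ≤ Real.log (bndU A X K L R R) := by
    apply Real.log_nonneg
    rw [bndU]
    exact one_le_mul_of_one_le_of_one_le (one_le_pow₀ (by linarith)) (one_le_pow₀ hA)
  have hdU : (d - 1) * Real.log (bndU A X K L R R) ≤
      (d - 1) * (4096 * d * w ^ 2 * J * (l₀ + 2 * J)) + 2048 * d ^ 2 * w ^ 2 * J ^ 2 := by
    have hd0 : 0 ≤ d - 1 := by linarith
    calc (d - 1) * Real.log (bndU A X K L R R)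
        ≤ (d - 1) * (4096 * d * w ^ 2 * J * (l₀ + 2 * J) + 8192 * d ^ 2 * w * J ^ 2 * Real.log A) :=
          mul_le_mul_of_nonneg_left hU hd0
      _ = (d - 1) * (4096 * d * w ^ 2 * J * (l₀ + 2 * J)) +
            2048 * d ^ 2 * w * J ^ 2 * (4 * (d - 1) * Real.log A) := by ring
      _ ≤ (d - 1) * (4096 * d * w ^ 2 * J * (l₀ + 2 * J)) + 2048 * d ^ 2 * w * J ^ 2 * w := by
          have := mul_le_mul_of_nonneg_left hla (show 0 ≤ 2048 * d ^ 2 * w * J ^ 2 by positivity)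
          linarith
      _ = (d - 1) * (4096 * d * w ^ 2 * J * (l₀ + 2 * J)) + 2048 * d ^ 2 * w ^ 2 * J ^ 2 := by ring
  -- (f) `log V₂`
  have hV₂ : Real.log (bndV₂ t X K L R) ≤
      4096 * d * w ^ 2 * J * (l₀ + 2 * J) + 2048 * d ^ 2 * w ^ 2 * J ^ 2 := by
    rw [bndV₂, Real.log_mul (pow_pos hXpos _).ne' (Real.exp_pos _).ne', Real.log_pow, Real.log_exp]
    have h1 : ((K - 1 : ℕ) : ℝ) * Real.log X ≤ 4096 * d * w ^ 2 * J * (l₀ + 2 * J) := by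
      rw [← hKr]; exact mul_le_mul hK1r hlogX hlogX0 hKr0
    have h2 : ((L : ℝ) - 1) * (t * X + 4 * R) ≤ 2048 * d ^ 2 * w ^ 2 * J ^ 2 := by
      have h3 : t * X + 4 * R ≤ 512 * d * w * J * (m₁ + 2) := by rw [hRr]; linarith [htX]
      calc ((L : ℝ) - 1) * (t * X + 4 * R) ≤ L * (512 * d * w * J * (m₁ + 2)) :=
            mul_le_mul hL1r h3 (by positivity) (by positivity)
        _ = 8 * d * J * (512 * d * w * J) * (m₁ + 2) := by rw [hLr]; ring
        _ ≤ 8 * d * J * (512 * d * w * J) * (w / 2) :=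
            mul_le_mul_of_nonneg_left hm2 (by positivity)
        _ = 2048 * d ^ 2 * w ^ 2 * J ^ 2 := by ring
    linarith
  -- (g) `log N`
  have hlogN : Real.log (N : ℝ) ≤ 2 * l₀ + 2 * J := by
    have h1 : (N : ℝ) ≤ (1024 * d * w) ^ 2 * J ^ 2 := by rw [hNr]; linarith [sq_nonneg (d * w * J)]
    have h2 : Real.log (N : ℝ) ≤ Real.log ((1024 * d * w) ^ 2 * J ^ 2) :=
      Real.log_le_log (by linarith) h1
    have hdw : 0 < 1024 * d * w := by positivity
    have h3 : Real.log ((1024 * d * w) ^ 2 * J ^ 2) = 2 * l₀ + 2 * Real.log J := by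
      rw [Real.log_mul (pow_pos hdw 2).ne' (pow_pos (by linarith : (0 : ℝ) < J) 2).ne', Real.log_pow,
        Real.log_pow, hl₀, hd, hw]
      push_cast; ring
    have h4 : Real.log J ≤ J := Real.log_le_self (by linarith)
    linarith
  have hlogN0 : 0 ≤ Real.log (N : ℝ) := Real.log_nonneg hNr1
  have hlog2 : Real.log 2 < 0.6931471808 := Real.log_two_lt_d9
  have hlog20 : 0 ≤ Real.log 2 := Real.log_nonneg (by norm_num)
  -- (h) the main inequality of the core estimate
  have haux := ineq_aux hd1 hw4 hJ2 hl₀0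
  have hmain : Real.log 2 + D * ((K * L : ℕ) * Real.log (K * L : ℕ)) +
      (K * L : ℕ) * Real.log (bndV₁ (‖l₁‖ / b₂) (bigX b₁ b₂ R R) (Real.exp 1) K L) +
      ((D : ℝ) - 1) * ((K * L : ℕ) * Real.log (bndU A (bigX b₁ b₂ R R) K L R R)) ≤
        ((K * L * (K * L - 1) / 2 : ℕ) : ℝ) := by
    rw [← hNdef, ← hXdef, ← htdef, ← hd]
    -- the right-hand side is `N(N-1)/2`
    have hrhs : ((N * (N - 1) / 2 : ℕ) : ℝ) = (N : ℝ) * ((N : ℝ) - 1) / 2 := by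
      have h2 : (N * (N - 1) / 2) * 2 = N * (N - 1) := Nat.div_two_mul_two_of_even (Nat.even_mul_pred_self N)
      have h3 : ((N * (N - 1) / 2 : ℕ) : ℝ) * 2 = (N : ℝ) * ((N : ℝ) - 1) := by
        have := congrArg (fun x : ℕ => (x : ℝ)) h2
        push_cast [Nat.cast_sub hN1] at this
        exact this
      linarith
    rw [hrhs]
    -- bound the left-hand side by `log 2 + N · Q₁`
    set Q₁ : ℝ := d * (2 * l₀ + 2 * J) + (4096 * d * w ^ 2 * J * (1 + l₀ + 2 * J) +
      2048 * d ^ 2 * w ^ 2 * J ^ 2) + ((d - 1) * (4096 * d * w ^ 2 * J * (l₀ + 2 * J)) +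
      2048 * d ^ 2 * w ^ 2 * J ^ 2) with hQ₁
    have hN0 : (0 : ℝ) ≤ N := by positivity
    have h1 : d * ((N : ℝ) * Real.log N) + N * Real.log (bndV₁ t X (Real.exp 1) K L) +
        (d - 1) * (N * Real.log (bndU A X K L R R)) ≤ N * Q₁ := by
      have e : d * ((N : ℝ) * Real.log N) + N * Real.log (bndV₁ t X (Real.exp 1) K L) +
          (d - 1) * (N * Real.log (bndU A X K L R R)) =
          N * (d * Real.log N + Real.log (bndV₁ t X (Real.exp 1) K L) +
            (d - 1) * Real.log (bndU A X K L R R)) := by ring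
      rw [e, hQ₁]
      apply mul_le_mul_of_nonneg_left _ hN0
      have : d * Real.log N ≤ d * (2 * l₀ + 2 * J) := mul_le_mul_of_nonneg_left hlogN (by linarith)
      linarith
    -- `Q₁ + log 2 + 1/2 ≤ 16384 d²w²J²`
    have h2 : Q₁ + Real.log 2 + 1 / 2 ≤ 16384 * d ^ 2 * w ^ 2 * J ^ 2 := by
      rw [hQ₁]; linarith [haux, hlog2]
    have h3 : Real.log 2 + (N : ℝ) * Q₁ ≤ N * (Q₁ + Real.log 2) := by
      have : Real.log 2 ≤ N * Real.log 2 := le_mul_of_one_le_left hlog20 hNr1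
      linarith
    have h4 : (N : ℝ) * (Q₁ + Real.log 2) ≤ N * (16384 * d ^ 2 * w ^ 2 * J ^ 2 - 1 / 2) :=
      mul_le_mul_of_nonneg_left (by linarith) hN0
    have h5 : (N : ℝ) * (16384 * d ^ 2 * w ^ 2 * J ^ 2 - 1 / 2) = (N : ℝ) * ((N : ℝ) - 1) / 2 := by
      rw [hNr]; ring
    linarith
  -- apply the log form of the core estimate
  have hcore := lower_bound_log φ a₁ a₂ hA hA₁ hA₂ hl₁ hl₂ hb₂ hK2 hL2 hRS hx hy D hD hmain
  refine le_trans ?_ hcore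
  rw [Real.exp_le_exp, neg_le_neg_iff, ← hNdef, ← hXdef, ← htdef, ← hd]
  -- bound the exponent by `10⁹ d⁴ w⁴ J⁴`
  set Q₂ : ℝ := d * (2 * l₀ + 2 * J) + (4096 * d * w ^ 2 * J * (l₀ + 2 * J) +
    2048 * d ^ 2 * w ^ 2 * J ^ 2) + ((d - 1) * (4096 * d * w ^ 2 * J * (l₀ + 2 * J)) +
    2048 * d ^ 2 * w ^ 2 * J ^ 2) with hQ₂
  have hN0 : (0 : ℝ) ≤ N := by positivity
  have h1 : d * ((N : ℝ) * Real.log N) + N * Real.log (bndV₂ t X K L R) +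
      (d - 1) * (N * Real.log (bndU A X K L R R)) ≤ N * Q₂ := by
    have e : d * ((N : ℝ) * Real.log N) + N * Real.log (bndV₂ t X K L R) +
        (d - 1) * (N * Real.log (bndU A X K L R R)) =
        N * (d * Real.log N + Real.log (bndV₂ t X K L R) + (d - 1) * Real.log (bndU A X K L R R)) := by
      ring
    rw [e, hQ₂]
    apply mul_le_mul_of_nonneg_left _ hN0
    have : d * Real.log N ≤ d * (2 * l₀ + 2 * J) := mul_le_mul_of_nonneg_left hlogN (by linarith)
    linarith
  have h2 : Q₂ ≤ 16385 * d ^ 2 * w ^ 2 * J ^ 2 := by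
    rw [hQ₂]
    have hl : l₀ ≤ J := by linarith
    have hA1 : 4096 * d ^ 2 * w ^ 2 * J * l₀ ≤ 4096 * d ^ 2 * w ^ 2 * J * J :=
      mul_le_mul_of_nonneg_left hl (by positivity)
    have hA2 : 2 * d * l₀ ≤ 2 * d * J := mul_le_mul_of_nonneg_left hl (by positivity)
    have hw16 : 16 ≤ w ^ 2 := by nlinarith only [hw4]
    have hdd : d ≤ d ^ 2 := by nlinarith only [hd1]
    have h4 : 4 * d * J ≤ d ^ 2 * w ^ 2 * J ^ 2 := by
      have h5 : 4 * (d * J) ≤ w ^ 2 * (d * J) :=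
        mul_le_mul_of_nonneg_right (by linarith) (by positivity)
      have h6 : d * (w ^ 2 * J) ≤ d ^ 2 * (w ^ 2 * J) :=
        mul_le_mul_of_nonneg_right hdd (by positivity)
      have hJJ : J ≤ J ^ 2 := by nlinarith only [hJ2']
      have h7 : d ^ 2 * w ^ 2 * J ≤ d ^ 2 * w ^ 2 * J ^ 2 :=
        mul_le_mul_of_nonneg_left hJJ (by positivity)
      linarith
    linarith
  have h3 : (N : ℝ) * Q₂ ≤ 32768 * d ^ 2 * w ^ 2 * J ^ 2 * (16385 * d ^ 2 * w ^ 2 * J ^ 2) := by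
    rw [← hNr]; exact mul_le_mul_of_nonneg_left h2 hN0
  have h4 : (1 : ℝ) ≤ d ^ 4 * w ^ 4 * J ^ 4 := by
    have : (1 : ℝ) ≤ d * w * J :=
      one_le_mul_of_one_le_of_one_le (one_le_mul_of_one_le_of_one_le hd1 (by linarith)) (by linarith)
    calc (1 : ℝ) = 1 ^ 4 := by norm_num
      _ ≤ (d * w * J) ^ 4 := pow_le_pow_left₀ zero_le_one this 4
      _ = d ^ 4 * w ^ 4 * J ^ 4 := by ring
  linarith

end Explicit

end TwoLog

end Literature.NumberTheory.Transcendental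

end
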